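import Mathlib
import Literature.Analysis.FluidPDE.Tao2016AveragedNS.ShiftSetCascadeFlows
import Literature.Analysis.FluidPDE.Tao2016AveragedNS.ShiftSetCascadeFlux
import Literature.Analysis.FluidPDE.Tao2016AveragedNS.WeightedLatticeFlowsOn
import Summits.NavierStokesRegularity.NavierStokesRegularity.Theorems.TaoLadderRungTwoFlatCertificateGlueBoundsOn
import Summits.NavierStokesRegularity.NavierStokesRegularity.Theorems.HeteroclinicTriggerChainTriggerChainFrontStepWeightedSolution
import HarnessLib

/-!
# Certificate glue on a shift set `𝕊`, II: EXISTENCE of the exact flow on the whole clock window from every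
  state of the ball — the (exist₀) clause of `GapData₂On 𝕊` from a window certificate (helper for item
  stmt-NavierStokesRegularity-22987 `FlatGapCertificatesV2`, crux K_A♭ of route TaoLadderRungTwoFlat;
  cell harvest/h2-tao-ladder, p1 g13)

(exist₀) of the format-A♭ certificate asks: from EVERY state `S₀` of the weighted `r`-ball around the
reference set, the exact `𝕊`-lattice flow exists on the whole clock window `[0, c]` (in the a priori class
(4.5)). By the continuation criterion of `Literature…WeightedLatticeFlowsOn`
(`exists_exact_pseudoFlowOnShift_of_apriori_bound`: Picard–Lindelöf + continuation in the weighted sup-norm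
Banach space `Fin m × ℤ →ᵇ ℝ`) it suffices to bound every conjugated solution `T = ω·S` on `[0,s] ⊆ [0,c]`
a priori; `pseudoFlowOnShift_of_conjugated` reads such a `T` as an exact `PseudoFlowOnShift` on `[0, s]`, and
the all-shell bounds of glue I (`CertificateGlueOn.exact_flow_bounds`: window certificate + frozen wake +
Gaussian tail zone) bound it: `ω_k |S_{i,k}| ≤ Ω (M_max + C_z + r + D_max + ν_max r)`. The Banach-space
weight `ω` is any admissible weight dominated by `Ω` up to the window top and by `Ω · w_{k-1}` beyond it
(the tail zone controls shell `K` at the tolerance `r/w_{K-1}` of the shell below; e.g. `ω_k = w_{k-1}`).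
Result: `exists_exact_flow_on_window` — (exist₀) for the certificate's reference set.

HONEST FRAMING: Tao-type MODEL lattice flows on a general nearest-neighbour slot-closed shift set
`𝕊 ∌ (1,1,1)`; the window certificate's clauses are HYPOTHESES; nothing here is a statement about the
Navier–Stokes equations.
-/

noncomputable section

-- the sub-problem namespace repeats the summit name by design (D-0017)
set_option linter.dupNamespace false

namespace Summit.NavierStokesRegularity.NavierStokesRegularity.Theorems

open Set Filter Topology MeasureTheory intervalIntegral BoundedContinuousFunction Literature.Analysis.FluidPDE
  Literature.Analysis.FluidPDE.TaoCascade
open Summit.NavierStokesRegularity.NavierStokesRegularity.Theorems.GappedFrontRobustOn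

namespace CertificateGlueOn

variable {m : ℕ} {𝕊 : Finset (ℤ × ℤ × ℤ)}

/-! ### A conjugated solution is an exact flow -/

/-- **A solution of the conjugated equation is an exact flow.** If `T : ℝ → (Fin m × ℤ →ᵇ ℝ)` solves
`T' = F_ω(T)` on `[0, s]` (`s > 0`; `F_ω` the conjugated `𝕊`-lattice field for admissible weights `ω` with
`(1+(1+ε₀)^{10k})/ω_k ≤ D`) from `T(0) = ω·S₀`, then `S_{i,k}(t) := T(t)_{(i,k)}/ω_k` is an EXACT
`PseudoFlowOnShift 𝕊 s ε₀ α 0 0 S₀ (½S₀²) 0 S (½S²)` (the a priori class (4.5) from the continuity of `T`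
on the compact interval). [cite: Tao2016AveragedNS, §4 Lemma 4.1 (4.5), (4.8)–(4.10) with (4.12); Teschl2012, Thm 2.2] -/
theorem pseudoFlowOnShift_of_conjugated {ε₀ A Mα D s : ℝ} {α : Fin m → Fin m → Fin m → ℤ × ℤ × ℤ → ℝ}
    {ω : ℤ → ℝ} (hε : 0 ≤ 1 + ε₀) (hω : WeightRatiosLEOn 𝕊 ε₀ ω A) (hMα : 0 ≤ Mα)
    (hα : ∀ i₁ i₂ i₃ μ, |α i₁ i₂ i₃ μ| ≤ Mα) (hD : ∀ k : ℤ, (1 + (1 + ε₀) ^ ((10 : ℝ) * k)) / ω k ≤ D)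
    (hs : 0 < s) (S₀ : Fin m → ℤ → ℝ) {T : ℝ → (Fin m × ℤ →ᵇ ℝ)} (hT0 : ∀ i k, T 0 (i, k) = ω k * S₀ i k)
    (hT : ∀ t ∈ Icc 0 s, HasDerivWithinAt T (weightedFieldOn hε hω hMα hα (T t)) (Icc 0 s) t) :
    PseudoFlowOnShift 𝕊 s ε₀ α 0 0 S₀ (fun i k => (1 / 2) * S₀ i k ^ 2) (fun _ _ => 0)
      (fun i k t => T t (i, k) / ω k) (fun i k t => (1 / 2) * (T t (i, k) / ω k) ^ 2) := by
  obtain ⟨hωpos, -⟩ := id hω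
  have hTcont : ContinuousOn T (Icc 0 s) := fun t ht => (hT t ht).continuousWithinAt
  -- a uniform bound of `T` on the compact interval
  obtain ⟨B, hB⟩ : ∃ B, ∀ t ∈ Icc 0 s, ‖T t‖ ≤ B := by
    obtain ⟨B, hB⟩ := (isCompact_Icc.image_of_continuousOn hTcont).isBounded.exists_norm_le
    exact ⟨B, fun t ht => hB _ (mem_image_of_mem T ht)⟩
  have hB0 : 0 ≤ B := (norm_nonneg _).trans (hB 0 ⟨le_rfl, hs.le⟩)
  have hD0 : 0 ≤ D := le_trans (div_nonneg (by positivity) (hωpos 0).le) (hD 0)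
  -- coordinates: derivative within `[0,s]`
  have hcoord : ∀ (i : Fin m) (k : ℤ), ∀ t ∈ Icc 0 s,
      HasDerivWithinAt (fun u => T u (i, k) / ω k)
        (quadTermOn 𝕊 ε₀ α (fun j n (_ : ℝ) => T t (j, n) / ω n) i k 0) (Icc 0 s) t := by
    intro i k t ht
    have h0 := ((BoundedContinuousFunction.evalCLM ℝ (i, k) :
        (Fin m × ℤ →ᵇ ℝ) →L[ℝ] ℝ).hasFDerivAt).comp_hasDerivWithinAt t (hT t ht)
    have h1 : HasDerivWithinAt (fun u => T u (i, k)) (weightedFieldOn hε hω hMα hα (T t) (i, k))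
        (Icc 0 s) t := by
      simpa [Function.comp_def] using h0
    have h2 := h1.div_const (ω k)
    rw [weightedFieldOn_apply, mul_div_cancel_left₀ _ (hωpos k).ne'] at h2
    exact h2
  -- the nonlinearity along `T` at frozen time equals the nonlinearity of the family
  have hquad : ∀ (i : Fin m) (k : ℤ) (t : ℝ),
      quadTermOn 𝕊 ε₀ α (fun j n (_ : ℝ) => T t (j, n) / ω n) i k 0 =
        quadTermOn 𝕊 ε₀ α (fun j n u => T u (j, n) / ω n) i k t := by
    intro i k t; rfl
  have hrhs_cont : ∀ (i : Fin m) (k : ℤ),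
      ContinuousOn (fun t => quadTermOn 𝕊 ε₀ α (fun j n (_ : ℝ) => T t (j, n) / ω n) i k 0) (Icc 0 s) := by
    intro i k
    have hc' : ∀ (j : Fin m) (n : ℤ), ContinuousOn (fun t => T t (j, n) / ω n) (Icc 0 s) :=
      fun j n => (((BoundedContinuousFunction.evalCLM ℝ (j, n) :
        (Fin m × ℤ →ᵇ ℝ) →L[ℝ] ℝ).continuous).comp_continuousOn hTcont).div_const _
    simp only [quadTermOn]
    refine continuousOn_finsetSum _ fun i₁ _ => continuousOn_finsetSum _ fun i₂ _ =>
      continuousOn_finsetSum _ fun μ _ => ?_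
    exact (continuousOn_const.mul ((hc' _ _).mul (hc' _ _)))
  -- pointwise weighted bound
  have hptw : ∀ t ∈ Icc 0 s, ∀ (i : Fin m) (k : ℤ), |T t (i, k) / ω k| ≤ B / ω k := by
    intro t ht i k
    rw [abs_div, abs_of_pos (hωpos k)]
    exact div_le_div_of_nonneg_right
      (((Real.norm_eq_abs _).symm.le.trans ((T t).norm_coe_le_norm (i, k))).trans (hB t ht)) (hωpos k).le
  refine
    { contDiffOn_S := fun i k => htcWS_contDiffOn_one_Icc hs (hcoord i k) (hrhs_cont i k)
      contDiffOn_F := fun i k => ?_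
      nonneg_F := fun i k t _ => by positivity
      apriori_S := ⟨D * B, fun t ht i k => ?_⟩
      apriori_F := ⟨D * B, fun t ht i k => ?_⟩
      init_S := fun i k => by
        show T 0 (i, k) / ω k = S₀ i k
        rw [hT0, mul_div_cancel_left₀ _ (hωpos k).ne']
      init_F := fun i k => by
        show (1 / 2) * (T 0 (i, k) / ω k) ^ 2 = (1 / 2) * S₀ i k ^ 2
        rw [hT0, mul_div_cancel_left₀ _ (hωpos k).ne']
      motion := fun i k t ht => by
        rw [(hcoord i k t ht).derivWithin (uniqueDiffOn_Icc hs t ht)]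
        simp only [quadTermOn, sub_self, abs_zero, zero_mul, le_refl]
      energy := fun i k t ht => by
        have h := ((hcoord i k t ht).pow 2).const_mul (1 / 2 : ℝ)
        have h' : HasDerivWithinAt (fun u => (1 / 2) * (T u (i, k) / ω k) ^ 2)
            (quadTermOn 𝕊 ε₀ α (fun j n (_ : ℝ) => T t (j, n) / ω n) i k 0 * (T t (i, k) / ω k))
            (Icc 0 s) t :=
          h.congr_deriv (by rw [show (2 : ℕ) - 1 = 1 from rfl, pow_one, Nat.cast_ofNat]; ring)
        show derivWithin (fun u => (1 / 2) * (T u (i, k) / ω k) ^ 2) (Icc 0 s) t ≤ _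
        rw [h'.derivWithin (uniqueDiffOn_Icc hs t ht)]
        exact le_of_eq rfl
      defect_lower := fun i k t _ => le_rfl
      defect_upper := fun i k t _ => by simp }
  · -- `½ S²` is `C¹`
    have h2 : ∀ t ∈ Icc 0 s, HasDerivWithinAt (fun u => (1 / 2) * (T u (i, k) / ω k) ^ 2)
        ((1 / 2) * (↑(2 : ℕ) * (T t (i, k) / ω k) ^ (2 - 1) *
          quadTermOn 𝕊 ε₀ α (fun j n (_ : ℝ) => T t (j, n) / ω n) i k 0)) (Icc 0 s) t :=
      fun t ht => ((hcoord i k t ht).pow 2).const_mul (1 / 2 : ℝ)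
    refine htcWS_contDiffOn_one_Icc hs h2 ?_
    have hc' : ContinuousOn (fun t => T t (i, k) / ω k) (Icc 0 s) :=
      (((BoundedContinuousFunction.evalCLM ℝ (i, k) :
        (Fin m × ℤ →ᵇ ℝ) →L[ℝ] ℝ).continuous).comp_continuousOn hTcont).div_const _
    exact continuousOn_const.mul ((continuousOn_const.mul (hc'.pow _)).mul (hrhs_cont i k))
  · -- a priori bound on the amplitudes
    have hpow : 0 ≤ 1 + (1 + ε₀) ^ ((10 : ℝ) * k) := by positivity
    calc (1 + (1 + ε₀) ^ ((10 : ℝ) * k)) * |T t (i, k) / ω k|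
        ≤ (1 + (1 + ε₀) ^ ((10 : ℝ) * k)) * (B / ω k) := mul_le_mul_of_nonneg_left (hptw t ht i k) hpow
      _ = (1 + (1 + ε₀) ^ ((10 : ℝ) * k)) / ω k * B := by ring
      _ ≤ D * B := mul_le_mul_of_nonneg_right (hD k) hB0
  · -- a priori bound on the energies
    have hpow : 0 ≤ 1 + (1 + ε₀) ^ ((10 : ℝ) * k) := by positivity
    have hsq : Real.sqrt ((1 / 2) * (T t (i, k) / ω k) ^ 2) ≤ |T t (i, k) / ω k| :=
      calc Real.sqrt ((1 / 2 : ℝ) * (T t (i, k) / ω k) ^ 2) ≤ Real.sqrt ((T t (i, k) / ω k) ^ 2) :=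
            Real.sqrt_le_sqrt (by nlinarith [sq_nonneg (T t (i, k) / ω k)])
        _ = |T t (i, k) / ω k| := Real.sqrt_sq_eq_abs _
    calc (1 + (1 + ε₀) ^ ((10 : ℝ) * k)) * Real.sqrt ((1 / 2) * (T t (i, k) / ω k) ^ 2)
        ≤ (1 + (1 + ε₀) ^ ((10 : ℝ) * k)) * (B / ω k) :=
          mul_le_mul_of_nonneg_left (hsq.trans (hptw t ht i k)) hpow
      _ = (1 + (1 + ε₀) ^ ((10 : ℝ) * k)) / ω k * B := by ring
      _ ≤ D * B := mul_le_mul_of_nonneg_right (hD k) hB0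

/-- The weighted state `(i,k) ↦ ω_k S₀_{i,k}` as a point of `Fin m × ℤ →ᵇ ℝ` of norm `≤ B`, when
`ω_k |S₀_{i,k}| ≤ B`. [folklore] -/
theorem exists_weightedState {ω : ℤ → ℝ} {B : ℝ} (hB : 0 ≤ B) (S₀ : Fin m → ℤ → ℝ)
    (h : ∀ i k, ω k * |S₀ i k| ≤ B) (hω : ∀ k, 0 < ω k) :
    ∃ T₀ : Fin m × ℤ →ᵇ ℝ, (∀ i k, T₀ (i, k) = ω k * S₀ i k) ∧ ‖T₀‖ ≤ B := by
  refine ⟨ofNormedAddCommGroupDiscrete (fun p : Fin m × ℤ => ω p.2 * S₀ p.1 p.2) B fun p => ?_,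
    fun i k => rfl, ?_⟩
  · rw [Real.norm_eq_abs, abs_mul, abs_of_pos (hω p.2)]
    exact h p.1 p.2
  · exact (norm_le hB).2 fun p => by
      rw [Real.norm_eq_abs]
      show |ω p.2 * S₀ p.1 p.2| ≤ B
      rw [abs_mul, abs_of_pos (hω p.2)]
      exact h p.1 p.2

/-! ### (exist₀) from the window certificate -/

/-- **THE EXACT FLOW EXISTS ON THE WHOLE CLOCK WINDOW FROM EVERY STATE OF THE BALL** ((exist₀) of a
format-A♭ certificate). Hypotheses: those of glue I (`exact_flow_bounds`: shift set, table, window data,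
wake envelopes with the frozen-wake closing condition at horizon `c`, weights/quiet-tail statics at horizon
`c`, the certificate's interior and trapping clauses), plus: the table bounded by `1` everywhere
(`InTableClassOn`), `w ≥ 1`, uniform bounds `M_k ≤ M_max` on the window, `ν_K ≤ ν_max` beyond it, a wake-drift
bound `c·8Cα(1+ε₀)^{5j/2}Ẑf_j² ≤ D_max`, the reference state bounded (`|z| ≤ C_z`), and an ADMISSIBLE
Banach-space weight `ω` (`WeightRatiosLEOn 𝕊 ε₀ ω A`, `(1+(1+ε₀)^{10k})/ω_k ≤ D`) with `ω_k ≤ Ω` for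
`k ≤ Ka` and `ω_k ≤ Ω w_{k-1}` for `k > Ka`. Conclusion: for the start state `S₀` of the ball an exact
`PseudoFlowOnShift 𝕊 c ε₀ α 0 0 S₀ (½S₀²) 0 S F` exists on `[0, c]`.
[cite: Tao2016AveragedNS, §4 Lemma 4.1 (4.5), (4.8)–(4.10) with (4.12); Teschl2012, Cor. 2.16] -/
theorem exists_exact_flow_on_window (h𝕊 : IsNearestNeighbourSet 𝕊) (h𝕊c : IsSlotClosed 𝕊)
    (h111 : ((1 : ℤ), (1 : ℤ), (1 : ℤ)) ∉ 𝕊) {ε₀ : ℝ} (hε : 0 < ε₀)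
    {α : Fin m → Fin m → Fin m → ℤ × ℤ × ℤ → ℝ} (hαc : IsCancellingCoeffOn 𝕊 α)
    (hα1 : ∀ i₁ i₂ i₃ μ, |α i₁ i₂ i₃ μ| ≤ 1)
    {Cα : ℝ} (hCα0 : 0 ≤ Cα) (hCα : ∀ i, ∑ i₁, ∑ i₂, ∑ μ ∈ 𝕊, |α i₁ i₂ i μ| ≤ Cα)
    -- window, weights, radius, horizon
    {Kb Ka : ℤ} (hKb : 0 ≤ Kb) (hKa : 1 ≤ Ka) {Core : (Fin m → ℤ → ℝ) → Prop} {M w : ℤ → ℝ}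
    {r c : ℝ} (hr : 0 ≤ r) (hw1 : ∀ k, 1 ≤ w k) (hc : 0 < c)
    {Mmax : ℝ} (hMmax : ∀ k, -Kb ≤ k → k ≤ Ka → M k ≤ Mmax)
    -- wake side
    {Zb Zf : ℤ → ℝ} {Zmin Dmax : ℝ} (hZf : ∀ j, j ≤ -Kb → 0 < Zf j) (hZmin : 0 < Zmin)
    (hZmin' : ∀ j, j < -Kb → Zmin ≤ Zf j) (hZbf : ∀ j, j < -Kb → Zb j + r / w j ≤ Zf j / 2)
    (hMZf : M (-Kb) ≤ Zf (-Kb))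
    (hcloseB : ∀ j, j < -Kb →
      c * (8 * Cα * (1 + ε₀) ^ ((5 : ℝ) * j / 2) *
        max (Zf (j - 1)) (max (Zf j) (Zf (j + 1))) * max (Zf (j - 1)) (max (Zf j) (Zf (j + 1))) + 0) ≤
        Zf j / 2)
    (hDmax : ∀ j, j < -Kb →
      c * (8 * Cα * (1 + ε₀) ^ ((5 : ℝ) * j / 2) *
        max (Zf (j - 1)) (max (Zf j) (Zf (j + 1))) * max (Zf (j - 1)) (max (Zf j) (Zf (j + 1)))) ≤ Dmax)
    -- quiet side
    {Za ν : ℤ → ℝ} {ϑ νmax : ℝ}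
    (hT1 : ∀ k : ℤ, Ka ≤ k → 2 * (1 + ε₀) ^ (k : ℝ) * w k ≤ w (k + 1))
    (hZa : ∀ k : ℤ, Ka < k → 4 * (w k * Za k) ≤ r)
    (hcoreTop : ∀ z, Core z → ∀ i, 4 * (w Ka * |z i Ka|) ≤ r)
    (hthin : ∀ K : ℤ, Ka + 1 ≤ K →
      (1 + ε₀) ^ ((5 : ℝ) * K / 2) * r * w (K - 1) ≤ ϑ * w (K - 2) ^ 2)
    (hν : ∀ K : ℤ, Ka ≤ K → 0 ≤ ν K) (hνmax : ∀ K : ℤ, Ka ≤ K → ν K ≤ νmax)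
    (hcloseA : ∀ K : ℤ, Ka + 1 ≤ K →
      2 * (Real.sqrt 2 * Real.sqrt (4 / 3 * m * (25 / 32 + 0 * (1 + ε₀) ^ ((2 : ℝ) * K))) /
          (2 * (1 + ε₀) ^ ((K - 1 : ℤ) : ℝ)) +
        coeffAbsOn (botShifts 𝕊) α * c * (ϑ / (1 + ε₀) ^ ((5 : ℝ) / 2)) * ν (K - 1) ^ 2) ≤ ν K)
    (hslowA : ∀ K : ℤ, Ka + 1 ≤ K →
      (1 + ε₀) ^ ((5 : ℝ) * (K - 1 : ℤ) / 2) * coeffAbsOn (botShifts 𝕊) α * c *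
        (ν (K - 1) * r / w (K - 2)) ≤ 1 / 2)
    (hMν : M Ka ≤ ν Ka * r / w (Ka - 1))
    -- the certificate's interior and trapping clauses
    (hinside : ∀ (z S₀ : Fin m → ℤ → ℝ), Core z →
      (∀ i k, -Kb ≤ k → k ≤ Ka → w k * |S₀ i k - z i k| ≤ r) → ∀ i k, -Kb ≤ k → k ≤ Ka → |S₀ i k| < M k)
    (htrap : ∀ (s : ℝ) (z : Fin m → ℤ → ℝ) (S : Fin m → ℤ → ℝ → ℝ), Core z → 0 < s → s ≤ c →
      (∀ i k, -Kb ≤ k → k ≤ Ka → w k * |S i k 0 - z i k| ≤ r) →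
      (∀ i k, -Kb ≤ k → k ≤ Ka → ∀ u ∈ Icc 0 s,
        HasDerivWithinAt (S i k) (quadTermOn 𝕊 ε₀ α S i k u) (Icc 0 s) u) →
      (∀ i, ContinuousOn (S i (-Kb - 1)) (Icc 0 s)) → (∀ i, ContinuousOn (S i (Ka + 1)) (Icc 0 s)) →
      (∀ i, ∀ u ∈ Icc 0 s, |S i (-Kb - 1) u| ≤ Zf (-Kb - 1)) →
      (∀ i, ∀ u ∈ Icc 0 s, |S i (Ka + 1) u| ≤ ν (Ka + 1) * r / w Ka) →
      (∀ i k, -Kb ≤ k → k ≤ Ka → ∀ u ∈ Icc 0 s, |S i k u| ≤ M k) →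
        ∀ i k, -Kb ≤ k → k ≤ Ka → ∀ u ∈ Icc 0 s, |S i k u| < M k)
    -- the Banach-space weight
    {ω : ℤ → ℝ} {A D Ω : ℝ} (hω : WeightRatiosLEOn 𝕊 ε₀ ω A) (hA : 0 ≤ A)
    (hD : ∀ k : ℤ, (1 + (1 + ε₀) ^ ((10 : ℝ) * k)) / ω k ≤ D) (hΩ : 0 ≤ Ω)
    (hωlow : ∀ k, k ≤ Ka → ω k ≤ Ω) (hωhigh : ∀ k, Ka < k → ω k ≤ Ω * w (k - 1))
    -- the start state
    {z : Fin m → ℤ → ℝ} {Cz : ℝ} (hzc : Core z) (hzb : ∀ i j, j < -Kb → |z i j| ≤ Zb j)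
    (hza : ∀ i k, Ka < k → |z i k| ≤ Za k) (hzC : ∀ i k, |z i k| ≤ Cz)
    {S₀ : Fin m → ℤ → ℝ} (hball : ∀ i k, w k * |S₀ i k - z i k| ≤ r) :
    ∃ S F : Fin m → ℤ → ℝ → ℝ,
      PseudoFlowOnShift 𝕊 c ε₀ α 0 0 S₀ (fun i k => (1 / 2) * S₀ i k ^ 2) (fun _ _ => 0) S F := by
  have hq : 0 < 1 + ε₀ := by linarith
  have hq1 : 1 ≤ 1 + ε₀ := by linarith
  have hwpos : ∀ k, 0 < w k := fun k => lt_of_lt_of_le one_pos (hw1 k)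
  have hωpos : ∀ k, 0 < ω k := hω.1
  -- nonnegative majorants (`max _ 0`, so that no sign hypotheses are needed)
  set Cz' : ℝ := max Cz 0 with hCz'
  set Mmax' : ℝ := max Mmax 0 with hMmax'
  set Dmax' : ℝ := max Dmax 0 with hDmax'
  set νmax' : ℝ := max νmax 0 with hνmax'
  have hCz'0 : 0 ≤ Cz' := le_max_right _ _
  have hMmax'0 : 0 ≤ Mmax' := le_max_right _ _
  have hDmax'0 : 0 ≤ Dmax' := le_max_right _ _
  have hνmax'0 : 0 ≤ νmax' := le_max_right _ _
  set B : ℝ := Ω * (Mmax' + Cz' + 2 * r + Dmax' + νmax' * r) with hB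
  have hB0 : 0 ≤ B := by positivity
  -- weights ahead are increasing from `Ka` on
  have hwmono : ∀ k : ℤ, Ka < k → w (k - 1) ≤ w k := by
    intro k hk
    have h1 := hT1 (k - 1) (by omega)
    rw [sub_add_cancel] at h1
    have h2 : (1 : ℝ) ≤ (1 + ε₀) ^ ((k - 1 : ℤ) : ℝ) :=
      Real.one_le_rpow hq1 (by exact_mod_cast (show (0 : ℤ) ≤ k - 1 by omega))
    have h3 : 0 ≤ w (k - 1) := (hwpos (k - 1)).le
    nlinarith
  -- generic weighted bound: `|x| ≤ X` with the right scale gives `ω_k |x| ≤ B`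
  -- start state: `ω_k |S₀_{i,k}| ≤ B`
  have hS₀z : ∀ i k, |S₀ i k| ≤ |z i k| + r / w k := by
    intro i k
    have h1 : |S₀ i k - z i k| ≤ r / w k := by
      rw [le_div_iff₀ (hwpos k), mul_comm]; exact hball i k
    calc |S₀ i k| = |(S₀ i k - z i k) + z i k| := by ring_nf
      _ ≤ |S₀ i k - z i k| + |z i k| := abs_add_le _ _
      _ ≤ |z i k| + r / w k := by linarith
  have hrw : ∀ k, r / w k ≤ r := fun k => div_le_self hr (hw1 k)
  have hzC' : ∀ i k, |z i k| ≤ Cz' := fun i k => (hzC i k).trans (le_max_left _ _)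
  have hsum_le_B : ∀ x : ℝ, 0 ≤ x → x ≤ Mmax' + Cz' + 2 * r + Dmax' + νmax' * r → Ω * x ≤ B :=
    fun x _ hx => mul_le_mul_of_nonneg_left hx hΩ
  have hT₀bd : ∀ i k, ω k * |S₀ i k| ≤ B := by
    intro i k
    by_cases hk : k ≤ Ka
    · calc ω k * |S₀ i k| ≤ Ω * (Cz' + r) := by
            refine mul_le_mul (hωlow k hk) ((hS₀z i k).trans (add_le_add (hzC' i k) (hrw k)))
              (abs_nonneg _) hΩ
        _ ≤ B := hsum_le_B _ (by positivity) (by nlinarith [hνmax'0, hr])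
    · push Not at hk
      have h1 : |S₀ i k| ≤ 5 / 4 * (r / w k) := by
        have hz1 : |z i k| ≤ r / (4 * w k) := by
          have := hZa k hk; have := hza i k hk; have := hwpos k
          rw [le_div_iff₀ (by positivity)]; nlinarith
        have : r / (4 * w k) = (1 / 4) * (r / w k) := by
          field_simp
        linarith [hS₀z i k]
      calc ω k * |S₀ i k| ≤ (Ω * w (k - 1)) * (5 / 4 * (r / w k)) :=
            mul_le_mul (hωhigh k hk) h1 (abs_nonneg _) (by have := hwpos (k - 1); positivity)
        _ = Ω * (5 / 4 * r) * (w (k - 1) / w k) := by field_simp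
        _ ≤ Ω * (5 / 4 * r) * 1 := by
            refine mul_le_mul_of_nonneg_left ?_ (by positivity)
            rw [div_le_one (hwpos k)]; exact hwmono k hk
        _ ≤ B := by rw [mul_one]; exact hsum_le_B _ (by positivity) (by nlinarith [hνmax'0, hr])
  obtain ⟨T₀, hT₀, hT₀B⟩ := exists_weightedState hB0 S₀ hT₀bd hωpos
  -- the a priori bound for conjugated solutions
  have hapriori : ∀ s ∈ Icc 0 c, ∀ T : ℝ → (Fin m × ℤ →ᵇ ℝ), T 0 = T₀ →
      (∀ t ∈ Icc 0 s, HasDerivWithinAt T (weightedFieldOn hq.le hω zero_le_one hα1 (T t)) (Icc 0 s) t) →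
        ∀ t ∈ Icc 0 s, ‖T t‖ ≤ B := by
    intro s hs T hT0 hT t ht
    rcases eq_or_lt_of_le hs.1 with hs0 | hs0
    · -- degenerate window
      have : t = 0 := le_antisymm (hs0 ▸ ht.2) ht.1
      rw [this, hT0]; exact hT₀B
    have hT0' : ∀ i k, T 0 (i, k) = ω k * S₀ i k := fun i k => by rw [hT0]; exact hT₀ i k
    have hflow' := pseudoFlowOnShift_of_conjugated hq.le hω zero_le_one hα1 hD hs0 S₀ hT0' hT
    obtain ⟨hwin, hbeh, hahd, -⟩ := exact_flow_bounds h𝕊 h𝕊c h111 hε hαc hCα0 hCα hKb hKa hr hwpos hZf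
      hZmin hZmin' hZbf hMZf hcloseB hT1 hZa hcoreTop hthin hν hcloseA hslowA hMν hinside htrap hzc hzb hza
      hball hs0 hs.2 hflow'
    refine (BoundedContinuousFunction.norm_le hB0).2 fun p => ?_
    obtain ⟨i, k⟩ := p
    have hrepr : ‖T t (i, k)‖ = ω k * |T t (i, k) / ω k| := by
      rw [Real.norm_eq_abs, abs_div, abs_of_pos (hωpos k), mul_div_cancel₀ _ (hωpos k).ne']
    rw [hrepr]
    by_cases hk1 : k < -Kb
    · -- frozen wake
      obtain ⟨-, hdrift⟩ := hbeh i k hk1 t ht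
      have h1 : |T t (i, k) / ω k| ≤ Cz' + r + Dmax' := by
        have hd := (hdrift.trans (hDmax k hk1)).trans (le_max_left Dmax 0)
        have h0 := (hS₀z i k).trans (add_le_add (hzC' i k) (hrw k))
        have : |T t (i, k) / ω k| ≤ |T t (i, k) / ω k - S₀ i k| + |S₀ i k| := by
          have := abs_add_le (T t (i, k) / ω k - S₀ i k) (S₀ i k); rwa [sub_add_cancel] at this
        linarith
      calc ω k * |T t (i, k) / ω k| ≤ Ω * (Cz' + r + Dmax') :=
            mul_le_mul (hωlow k (by omega)) h1 (abs_nonneg _) hΩ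
        _ ≤ B := hsum_le_B _ (by positivity) (by nlinarith [hνmax'0, hr])
    · push Not at hk1
      by_cases hk2 : k ≤ Ka
      · -- window
        have h1 : |T t (i, k) / ω k| ≤ Mmax' :=
          ((hwin i k hk1 hk2 t ht).le.trans (hMmax k hk1 hk2)).trans (le_max_left _ _)
        calc ω k * |T t (i, k) / ω k| ≤ Ω * Mmax' := mul_le_mul (hωlow k hk2) h1 (abs_nonneg _) hΩ
          _ ≤ B := hsum_le_B _ hMmax'0 (by nlinarith [hνmax'0, hr])
      · -- quiet tail
        push Not at hk2
        have h1 : |T t (i, k) / ω k| ≤ ν k * r / w (k - 1) := hahd k hk2.le t ht i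
        have hνk : ν k ≤ νmax' := (hνmax k hk2.le).trans (le_max_left _ _)
        have hνk0 : 0 ≤ ν k := hν k hk2.le
        calc ω k * |T t (i, k) / ω k| ≤ (Ω * w (k - 1)) * (ν k * r / w (k - 1)) :=
              mul_le_mul (hωhigh k hk2) h1 (abs_nonneg _) (by have := hwpos (k - 1); positivity)
          _ = Ω * (ν k * r) := by have := (hwpos (k - 1)).ne'; field_simp
          _ ≤ Ω * (νmax' * r) := mul_le_mul_of_nonneg_left (mul_le_mul_of_nonneg_right hνk hr) hΩ
          _ ≤ B := hsum_le_B _ (by positivity) (by nlinarith [hνmax'0, hr, hMmax'0, hCz'0, hDmax'0])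
  obtain ⟨S, hS, -⟩ := exists_exact_pseudoFlowOnShift_of_apriori_bound hq.le hω zero_le_one hα1 hA hD hc
    S₀ T₀ hT₀ hT₀B hapriori
  exact ⟨S, _, hS⟩

end CertificateGlueOn

end Summit.NavierStokesRegularity.NavierStokesRegularity.Theorems

end
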